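import Summits.ResolutionOfSingularities.KangarooAtlas.MizutaniMultiplicitySpecialization
import Summits.ResolutionOfSingularities.KangarooAtlas.MizutaniTriangular
import Summits.ResolutionOfSingularities.KangarooAtlas.MizutaniNumber
import HarnessLib

/-!
# `N = rad_L(k[F] N_e)`: the invariant forms of all levels are determined by the level `e ≥ exponent` (Mizutani Thm. 1.3)

Cell `pub-rosobs`, Mizutani enclosure (seat mizutani-encloser-1, gen 8).  AI-written; *AI review is weaker than
expert review*; NOT a resolution-of-singularities theorem (summit relevance C).

Mizutani 1973 Thm. 1.3 (= Oda 1973 Thm. 2.5) characterises the graded `k[F]`-submodules `N = U(𝔭) ∩ L ⊂ L` of the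
Hironaka schemes of exponent `e` by four conditions; two of them, «`e(N) = e`» and «`N = rad_L(k[F] N_e)`» with
`rad_L(Q) = {f ∈ L : ∃ j, F^j f ∈ Q}`, say that ALL levels of `N` are determined by the single subspace
`N_e ⊂ L_e`: the levels above `e` by `F`-generation (the tree's `ExponentLE`), the levels below `e` by taking
`F`-RADICALS.  The first is the definition of the exponent; this file proves the second for every point `𝔭` of
`ℙ^n_k` and EVERY level `e` (no exponent hypothesis):

* **`mem_hirForms_iff_frobVec_mem`** — `a ∈ (U(𝔭) ∩ L)_j ↔ F^m a ∈ (U(𝔭) ∩ L)_{j+m}`: the multiplicity of the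
  hypersurface `(Σ a_i X_i^{p^j})^{p^m} = Σ a_i^{p^m} X_i^{p^{j+m}}` at `𝔭` is `p^m` times that of `Σ a_i X_i^{p^j}`
  (`projMult_pow`, additivity of the multiplicity in the regular local ring `𝒪_{ℙⁿ,𝔭}`), so one is `≥ p^{j+m}` iff
  the other is `≥ p^j` — «`N = rad_L(k[F] N_e)`»; `mem_invForms_iff_frobVec_mem` (Oda's `(L_B)` via Oda's equality);
* **`hirForms_eq_of_hirForms_eq_of_le`** — two points whose level-`e` invariant forms agree agree at every level `j ≤ e`;
* **`bIdeal_eq_of_hirForms_eq`** — two points of exponent `≤ e` with the same `(U ∩ L)_e` have THE SAME HIRONAKA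
  SCHEME `U_+(𝔭)S = U_+(𝔶)S`: the scheme `B(𝔭)` is determined by the single subspace `(U(𝔭) ∩ L)_e ⊂ k^{n+1}` for
  any `e ≥ exponent B(𝔭)` (Mizutani's reduction of H-schemes of exponent `e` to pairs `(V, W)` at level `e`).

## References

* H. Mizutani, *Hironaka's additive group schemes*, Nagoya Math. J. 52 (1973) 85–95, Thm. 1.3 (p. 86: "N = rad_L(k[F]N_e),
  where rad_L(Q) = {f ∈ L | there exists j with F^j f ∈ Q}") and §1 (c). [Mizutani1973HironakaGroupSchemes]
* T. Oda, *Hironaka's additive group scheme, II*, Publ. RIMS 19 (1983), §2 (p. 1168). [Oda1983HironakaGroupSchemeII]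
-/

noncomputable section

open MvPolynomial Literature.AlgebraicGeometry.Resolution Literature.AlgebraicGeometry.Resolution.HironakaScheme
  Literature.RingTheory.HilbertSamuel

namespace Summit.ResolutionOfSingularities.KangarooAtlas.Mizutani

universe u

section Radical

variable (k : Type u) [Field k] (p : ℕ) [hp : Fact p.Prime] [CharP k p] {n : ℕ}
  (𝔭 : Ideal (MvPolynomial (Fin (n + 1)) k))

/-- **`N = rad_L(k[F] N_e)`, levelwise**: `a ∈ (U(𝔭) ∩ L)_j ↔ F^m a ∈ (U(𝔭) ∩ L)_{j+m}` for every point `𝔭` and all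
`j`, `m` — the hypersurface `Σ a_i^{p^m} X_i^{p^{j+m}} = (Σ a_i X_i^{p^j})^{p^m}` has multiplicity `p^m · mult` at `𝔭`.
[cite: Mizutani1973HironakaGroupSchemes, Thm. 1.3 (p. 86: N = rad_L(k[F] N_e))] -/
theorem mem_hirForms_iff_frobVec_mem [𝔭.IsPrime] (hP : IsPoint k 𝔭) (j m : ℕ) (a : Fin (n + 1) → k) :
    a ∈ hirForms k p 𝔭 j ↔ frobVec k p m a ∈ hirForms k p 𝔭 (j + m) := by
  rw [mem_hirForms_iff_le_projMult p hP j a, mem_hirForms_iff_le_projMult p hP (j + m) (frobVec k p m a),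
    ← addForm_pow_pow, pow_eq_zero_iff (pow_ne_zero _ hp.out.ne_zero)]
  by_cases h0 : addForm k p j a = 0
  · simp only [h0, true_or]
  · simp only [h0, false_or]
    have hdeg : p ^ (j + m) = p ^ m * p ^ j := by rw [pow_add, mul_comm]
    rw [hdeg, projMult_pow hP (addForm_mem_homogeneousSubmodule p j a) h0 (p ^ m)]
    exact (Nat.mul_le_mul_left_iff (Nat.pos_of_ne_zero (pow_ne_zero _ hp.out.ne_zero))).symm

/-- The same for Oda's `(L_B)_j` (Oda's equality `hirForms_eq_invForms`).
[cite: Oda1983HironakaGroupSchemeII, §2 (p. 1168); Mizutani1973HironakaGroupSchemes, Thm. 1.3] -/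
theorem mem_invForms_iff_frobVec_mem [𝔭.IsPrime] (hP : IsPoint k 𝔭) (j m : ℕ) (a : Fin (n + 1) → k) :
    a ∈ invForms k p 𝔭 j ↔ frobVec k p m a ∈ invForms k p 𝔭 (j + m) := by
  rw [← hirForms_eq_invForms 𝔭 j, ← hirForms_eq_invForms 𝔭 (j + m)]
  exact mem_hirForms_iff_frobVec_mem k p 𝔭 hP j m a

/-- **The levels `j ≤ e` are determined by the level `e`**: if `(U(𝔭) ∩ L)_e = (U(𝔶) ∩ L)_e` then
`(U(𝔭) ∩ L)_j = (U(𝔶) ∩ L)_j` for every `j ≤ e`. [cite: Mizutani1973HironakaGroupSchemes, Thm. 1.3 (N = rad_L(k[F] N_e))] -/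
theorem hirForms_eq_of_hirForms_eq_of_le {𝔶 : Ideal (MvPolynomial (Fin (n + 1)) k)} [𝔭.IsPrime] [𝔶.IsPrime]
    (hP : IsPoint k 𝔭) (hY : IsPoint k 𝔶) {e : ℕ} (h : hirForms k p 𝔭 e = hirForms k p 𝔶 e) {j : ℕ} (hj : j ≤ e) :
    hirForms k p 𝔭 j = hirForms k p 𝔶 j := by
  obtain ⟨m, rfl⟩ := Nat.exists_eq_add_of_le hj
  ext a
  rw [mem_hirForms_iff_frobVec_mem k p 𝔭 hP j m a, mem_hirForms_iff_frobVec_mem k p 𝔶 hY j m a, h]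

/-- … and the levels `j ≥ e` by `F`-generation when both points have exponent `≤ e`: ALL levels agree.
[cite: Mizutani1973HironakaGroupSchemes, Thm. 1.3 (e(N) = e and N = rad_L(k[F] N_e))] -/
theorem hirForms_eq_of_hirForms_eq {𝔶 : Ideal (MvPolynomial (Fin (n + 1)) k)} [𝔭.IsPrime] [𝔶.IsPrime]
    (hP : IsPoint k 𝔭) (hY : IsPoint k 𝔶) {e : ℕ} (hE : ExponentLE k p 𝔭 e) (hE' : ExponentLE k p 𝔶 e)
    (h : hirForms k p 𝔭 e = hirForms k p 𝔶 e) (j : ℕ) : hirForms k p 𝔭 j = hirForms k p 𝔶 j := by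
  rcases le_or_gt j e with hj | hj
  · exact hirForms_eq_of_hirForms_eq_of_le k p 𝔭 hP hY h hj
  · rw [hirForms_eq_invForms 𝔭 j, hirForms_eq_invForms 𝔶 j, hE j hj.le, hE' j hj.le, ← hirForms_eq_invForms 𝔭 e,
      ← hirForms_eq_invForms 𝔶 e, h]

/-- **THE HIRONAKA SCHEME IS DETERMINED BY ONE LEVEL**: two points `𝔭`, `𝔶` of `ℙ^n_k` of exponent `≤ e` with
`(U(𝔭) ∩ L)_e = (U(𝔶) ∩ L)_e` have `U_+(𝔭)S = U_+(𝔶)S`, i.e. `B_{P,𝔭} = B_{P,𝔶}` — Mizutani's reduction of the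
H-schemes of exponent `e` to data at level `e` (Thm. 1.3 / the pairs `(V, W)` of (*)).
[cite: Mizutani1973HironakaGroupSchemes, Thm. 1.3 and (*) of §1] -/
theorem bIdeal_eq_of_hirForms_eq {𝔶 : Ideal (MvPolynomial (Fin (n + 1)) k)} [𝔭.IsPrime] [𝔶.IsPrime]
    (hP : IsPoint k 𝔭) (hY : IsPoint k 𝔶) {e : ℕ} (hE : ExponentLE k p 𝔭 e) (hE' : ExponentLE k p 𝔶 e)
    (h : hirForms k p 𝔭 e = hirForms k p 𝔶 e) : bIdeal k 𝔭 = bIdeal k 𝔶 := by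
  rw [bIdeal_eq_famIdeal_hirForms_holds k p 𝔭 hP, bIdeal_eq_famIdeal_hirForms_holds k p 𝔶 hY]
  have hall : hirForms k p 𝔭 = hirForms k p 𝔶 := funext (hirForms_eq_of_hirForms_eq k p 𝔭 hP hY hE hE' h)
  rw [hall]

/-- Conversely (trivially) the scheme determines every level: `U_+(𝔭)S = U_+(𝔶)S ⇒ (U(𝔭) ∩ L)_j = (U(𝔶) ∩ L)_j`
(`addForm_mem_bIdeal_iff`); so for points of exponent `≤ e`, `B_{P,𝔭} = B_{P,𝔶} ↔ (U(𝔭) ∩ L)_e = (U(𝔶) ∩ L)_e`.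
[cite: Mizutani1973HironakaGroupSchemes, Thm. 1.3] -/
theorem bIdeal_eq_iff_hirForms_eq {𝔶 : Ideal (MvPolynomial (Fin (n + 1)) k)} [𝔭.IsPrime] [𝔶.IsPrime]
    (hP : IsPoint k 𝔭) (hY : IsPoint k 𝔶) {e : ℕ} (hE : ExponentLE k p 𝔭 e) (hE' : ExponentLE k p 𝔶 e) :
    bIdeal k 𝔭 = bIdeal k 𝔶 ↔ hirForms k p 𝔭 e = hirForms k p 𝔶 e := by
  refine ⟨fun h => ?_, bIdeal_eq_of_hirForms_eq k p 𝔭 hP hY hE hE'⟩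
  ext a
  rw [← addForm_mem_bIdeal_iff k p 𝔭 hP, ← addForm_mem_bIdeal_iff k p 𝔶 hY, h]

/-- At the exponent itself: `B(𝔭)` is determined by `(U(𝔭) ∩ L)_{exponent}` among points of no larger exponent.
[cite: Mizutani1973HironakaGroupSchemes, Thm. 1.3] -/
theorem bIdeal_eq_of_hirForms_exponent_eq {𝔶 : Ideal (MvPolynomial (Fin (n + 1)) k)} [𝔭.IsPrime] [𝔶.IsPrime]
    (hP : IsPoint k 𝔭) (hY : IsPoint k 𝔶) (hexp : exponent k p 𝔶 ≤ exponent k p 𝔭)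
    (h : hirForms k p 𝔭 (exponent k p 𝔭) = hirForms k p 𝔶 (exponent k p 𝔭)) : bIdeal k 𝔭 = bIdeal k 𝔶 :=
  bIdeal_eq_of_hirForms_eq k p 𝔭 hP hY (exponentLE_exponent k p 𝔭) ((exponent_le_iff k p 𝔶).mp hexp) h

end Radical

end Summit.ResolutionOfSingularities.KangarooAtlas.Mizutani

end
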